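import Summits.RiemannHypothesis.RiemannHypothesis.Theorems.SoloInformedGapPenetration
import HarnessLib

/-!
# T63 — time-limited functions leak: an explicit prolate-type lower bound

For a Weil test function `g` supported in `[-a, a]` and a frequency window `[-Ω, Ω]`, put
`E = ∫|g|²`, `L = ∫_{|t| ≥ Ω} |ĝ(1/2+it)|² dt` (the LEAK; `∫_ℝ |ĝ(1/2+it)|² = 2πE`).  Then

* `(2πE - L)³ ≤ 1024 (aΩ)³ e^{6aΩ} E L²`  (`weil_leak_cubic`), hence
* `L ≥ π^{3/2} / (32 (aΩ)^{3/2} e^{3aΩ}) · E` whenever `L ≤ πE`  (`weil_leak_lower_bound`), and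
* `L ≥ e^{-6aΩ} E` whenever `aΩ ≥ 1`  (`weil_leak_ge_exp_neg`).

So the largest eigenvalue `λ₀(c)`, `c = aΩ`, of time-and-band limiting satisfies the explicit,
non-asymptotic bound `1 - λ₀(c) ≥ (π^{1/2}/64) c^{-3/2} e^{-3c}` (the sharp rate is
`1 - λ₀(c) ~ 4√(πc) e^{-2c}`, Fuchs 1964).  Ingredients: gap penetration
(`two_pi_weilNorm2Sq_le_leak_add`, Phragmén–Lindelöf) converts a pointwise bound outside the
window into an energy bound; the Lipschitz bound `|ĝ(1/2+it) - ĝ(1/2+it')| ≤ a√(2a)√E |t - t'|`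
(`norm_weilMellin_line_sub_le`, from `(d/ds) ĝ = (t g)^`) converts the `L²` leak into a
pointwise bound: `|ĝ(1/2+it₀)|³ ≤ 8 a√(2a)√E · L` for `|t₀| ≥ Ω` (`norm_pow_three_le_of_lipschitz`).
Use (s19): the provable lower side of the size law for `ε(a) = weilGroundEnergy a`.
-/

open Complex Set Filter MeasureTheory Literature.NumberTheory.LFunctions
open scoped Real Topology

namespace Summit.RiemannHypothesis.RiemannHypothesis.Theorems

/-! ## `t ↦ t g(t)` and the derivative of `ĝ` along the critical line -/

/-- `t ↦ t g(t)` is a test function if `g` is. -/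
theorem ofReal_mul_isWeilTest {g : ℝ → ℂ} (hg : IsWeilTest g) :
    IsWeilTest fun x : ℝ ↦ (x : ℂ) * g x := by
  refine ⟨Complex.ofRealCLM.contDiff.mul hg.1, ?_⟩
  exact (hg.2.mul_left : HasCompactSupport ((fun x : ℝ ↦ (x : ℂ)) * g))

/-- `tsupport (t g) ⊆ tsupport g`. -/
theorem tsupport_ofReal_mul_subset (g : ℝ → ℂ) :
    tsupport (fun x : ℝ ↦ (x : ℂ) * g x) ⊆ tsupport g :=
  (tsupport_mul_subset_right : tsupport ((fun x : ℝ ↦ (x : ℂ)) * g) ⊆ tsupport g)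

/-- `∫ |t g(t)|² ≤ a² ∫ |g|²` for `g` supported in `[-a, a]`. -/
theorem integral_norm_sq_ofReal_mul_le {g : ℝ → ℂ} {a : ℝ} (hg : IsWeilTest g)
    (hga : tsupport g ⊆ Icc (-a) a) :
    ∫ x : ℝ, ‖(x : ℂ) * g x‖ ^ 2 ≤ a ^ 2 * ∫ x, ‖g x‖ ^ 2 := by
  rw [← integral_const_mul]
  have h2 : HasCompactSupport (fun x ↦ ‖g x‖ ^ 2) :=
    (hg.2.norm.comp_left (g := fun y : ℝ ↦ y ^ 2) (by simp) :
      HasCompactSupport ((fun y : ℝ ↦ y ^ 2) ∘ fun x ↦ ‖g x‖))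
  have hint : Integrable fun x ↦ ‖g x‖ ^ 2 :=
    (hg.1.continuous.norm.pow 2).integrable_of_hasCompactSupport h2
  refine integral_mono_of_nonneg
    (Eventually.of_forall fun x ↦ by simp only [Pi.zero_apply]; positivity)
    (hint.const_mul _) (Eventually.of_forall fun x ↦ ?_)
  by_cases hx : g x = 0
  · simp [hx]
  · have hxs : x ∈ Icc (-a) a := hga (subset_tsupport _ hx)
    dsimp only
    rw [norm_mul, mul_pow, Complex.norm_real, Real.norm_eq_abs, sq_abs]
    exact mul_le_mul_of_nonneg_right (sq_le_sq' hxs.1 hxs.2) (sq_nonneg _)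

/-- `(d/dt) ĝ(1/2 + it) = i · (t g)^(1/2 + it)`. -/
theorem weilMellin_line_hasDerivAt {g : ℝ → ℂ} (hg : IsWeilTest g) (t : ℝ) :
    HasDerivAt (fun t : ℝ ↦ weilMellin g (1 / 2 + t * I))
      (weilMellin (fun x : ℝ ↦ (x : ℂ) * g x) (1 / 2 + t * I) * I) t := by
  have h1 := hasDerivAt_weilMellin hg.1.continuous hg.2 (1 / 2 + t * I)
  have h2 : HasDerivAt (fun t : ℝ ↦ (1 / 2 : ℂ) + t * I) I t := by
    have := ((hasDerivAt_id t).ofReal_comp).mul_const I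
    simpa using this.const_add (1 / 2 : ℂ)
  have hD : (∫ x : ℝ, g x * (x * cexp ((1 / 2 + t * I - 1 / 2) * x))) =
      weilMellin (fun x : ℝ ↦ (x : ℂ) * g x) (1 / 2 + t * I) := by
    unfold weilMellin
    congr 1
    ext x
    ring
  rw [← hD]
  exact h1.comp t h2

/-- **Lipschitz bound on the line**: `|ĝ(1/2+it) - ĝ(1/2+it')| ≤ a √(2a) ‖g‖₂ |t - t'|`. -/
theorem norm_weilMellin_line_sub_le {g : ℝ → ℂ} {a : ℝ} (hg : IsWeilTest g)
    (hga : tsupport g ⊆ Icc (-a) a) (ha : 0 ≤ a) (t t' : ℝ) :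
    ‖weilMellin g (1 / 2 + t * I) - weilMellin g (1 / 2 + t' * I)‖ ≤
      a * (Real.sqrt (2 * a) * Real.sqrt (∫ x, ‖g x‖ ^ 2)) * |t - t'| := by
  set K := a * (Real.sqrt (2 * a) * Real.sqrt (∫ x, ‖g x‖ ^ 2)) with hK
  have hbound : ∀ u : ℝ, ‖weilMellin (fun x : ℝ ↦ (x : ℂ) * g x) (1 / 2 + u * I) * I‖ ≤ K := by
    intro u
    rw [norm_mul, Complex.norm_I, mul_one]
    have h := norm_weilMellin_le_window (ofReal_mul_isWeilTest hg)
      ((tsupport_ofReal_mul_subset g).trans hga) ha (1 / 2 + u * I)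
    have hre : |(1 / 2 + (u : ℂ) * I).re - 1 / 2| = 0 := by simp [mul_re]
    rw [hre, zero_mul, Real.exp_zero, one_mul] at h
    refine h.trans ?_
    have hs : Real.sqrt (∫ x : ℝ, ‖(x : ℂ) * g x‖ ^ 2) ≤ a * Real.sqrt (∫ x, ‖g x‖ ^ 2) := by
      calc Real.sqrt (∫ x : ℝ, ‖(x : ℂ) * g x‖ ^ 2)
          ≤ Real.sqrt (a ^ 2 * ∫ x, ‖g x‖ ^ 2) :=
            Real.sqrt_le_sqrt (integral_norm_sq_ofReal_mul_le hg hga)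
        _ = a * Real.sqrt (∫ x, ‖g x‖ ^ 2) := by
            rw [Real.sqrt_mul (sq_nonneg _), Real.sqrt_sq ha]
    rw [hK]
    calc Real.sqrt (2 * a) * Real.sqrt (∫ x : ℝ, ‖(x : ℂ) * g x‖ ^ 2)
        ≤ Real.sqrt (2 * a) * (a * Real.sqrt (∫ x, ‖g x‖ ^ 2)) :=
          mul_le_mul_of_nonneg_left hs (Real.sqrt_nonneg _)
      _ = a * (Real.sqrt (2 * a) * Real.sqrt (∫ x, ‖g x‖ ^ 2)) := by ring
  have key := (convex_univ (𝕜 := ℝ) (E := ℝ)).norm_image_sub_le_of_norm_hasDerivWithin_le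
    (f := fun t : ℝ ↦ weilMellin g (1 / 2 + t * I))
    (fun u _ ↦ (weilMellin_line_hasDerivAt hg u).hasDerivWithinAt) (fun u _ ↦ hbound u)
    (mem_univ t') (mem_univ t)
  simpa [Real.norm_eq_abs] using key

/-! ## From the `L²` leak to a pointwise bound -/

/-- A `K`-Lipschitz `F` with `‖F t₀‖ = η`, `|t₀| ≥ Ω`, keeps `‖F‖ ≥ η/2` on an interval of
length `η/(2K)` inside `{|t| ≥ Ω}`; hence `η³ ≤ 8K ∫_{|t| ≥ Ω} ‖F‖²`. -/
theorem norm_pow_three_le_of_lipschitz {F : ℝ → ℂ} {K Ω t₀ : ℝ} (hK : 0 < K)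
    (hlip : ∀ t t' : ℝ, ‖F t - F t'‖ ≤ K * |t - t'|)
    (hint : IntegrableOn (fun t ↦ ‖F t‖ ^ 2) {t : ℝ | Ω ≤ |t|}) (ht₀ : Ω ≤ |t₀|) :
    ‖F t₀‖ ^ 3 ≤ 8 * K * ∫ t in {t : ℝ | Ω ≤ |t|}, ‖F t‖ ^ 2 := by
  set S := {t : ℝ | Ω ≤ |t|} with hS
  set η := ‖F t₀‖ with hηdef
  have hη : 0 ≤ η := norm_nonneg _
  have hL : 0 ≤ ∫ t in S, ‖F t‖ ^ 2 := integral_nonneg fun _ ↦ by positivity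
  rcases hη.eq_or_lt with h0 | hpos
  · rw [← h0]
    simp only [ne_eq, OfNat.ofNat_ne_zero, not_false_eq_true, zero_pow]
    positivity
  set h := η / (2 * K) with hh
  have hh0 : 0 < h := div_pos hpos (by positivity)
  obtain ⟨J, hJS, hJm, hJvol, hJfin, hJt⟩ : ∃ J : Set ℝ, J ⊆ S ∧ MeasurableSet J ∧
      volume.real J = h ∧ volume J ≠ ⊤ ∧ ∀ t ∈ J, |t - t₀| ≤ h := by
    rcases le_or_gt 0 t₀ with hsgn | hsgn
    · refine ⟨Icc t₀ (t₀ + h), ?_, measurableSet_Icc, ?_, measure_Icc_lt_top.ne, ?_⟩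
      · intro t ht
        have h1 : Ω ≤ t₀ := by rwa [abs_of_nonneg hsgn] at ht₀
        show Ω ≤ |t|
        rw [abs_of_nonneg (by linarith [ht.1])]
        linarith [ht.1]
      · rw [Real.volume_real_Icc_of_le (by linarith)]
        ring
      · intro t ht
        rw [abs_le]
        constructor <;> linarith [ht.1, ht.2]
    · refine ⟨Icc (t₀ - h) t₀, ?_, measurableSet_Icc, ?_, measure_Icc_lt_top.ne, ?_⟩
      · intro t ht
        have h1 : Ω ≤ -t₀ := by rwa [abs_of_neg hsgn] at ht₀
        show Ω ≤ |t|
        rw [abs_of_nonpos (by linarith [ht.2])]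
        linarith [ht.2]
      · rw [Real.volume_real_Icc_of_le (by linarith)]
        ring
      · intro t ht
        rw [abs_le]
        constructor <;> linarith [ht.1, ht.2]
  have hlow : ∀ t ∈ J, (η / 2) ^ 2 ≤ ‖F t‖ ^ 2 := by
    intro t ht
    have h1 : ‖F t₀ - F t‖ ≤ K * h :=
      (hlip t₀ t).trans (by rw [abs_sub_comm]; exact mul_le_mul_of_nonneg_left (hJt t ht) hK.le)
    have hKh : K * h = η / 2 := by
      rw [hh]
      field_simp
    have h3 := norm_sub_norm_le (F t₀) (F t)
    have h2 : η / 2 ≤ ‖F t‖ := by linarith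
    exact pow_le_pow_left₀ (by positivity) h2 2
  have hJint : IntegrableOn (fun t ↦ ‖F t‖ ^ 2) J := hint.mono_set hJS
  have step1 := setIntegral_ge_of_const_le_real hJm hJfin hlow hJint
  have step2 : ∫ t in J, ‖F t‖ ^ 2 ≤ ∫ t in S, ‖F t‖ ^ 2 :=
    setIntegral_mono_set hint (ae_of_all _ fun _ ↦ by positivity) (ae_of_all _ hJS)
  rw [hJvol] at step1
  have h4 : (η / 2) ^ 2 * h = η ^ 3 / (8 * K) := by
    rw [hh]
    field_simp
    ring
  rw [h4] at step1
  have h5 := step1.trans step2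
  rw [div_le_iff₀ (by positivity)] at h5
  calc η ^ 3 ≤ (∫ t in S, ‖F t‖ ^ 2) * (8 * K) := h5
    _ = 8 * K * ∫ t in S, ‖F t‖ ^ 2 := by ring

/-! ## The leak inequality -/

/-- **Leak inequality (cubic form).** For a test function `g` supported in `[-a, a]`,
`a ≥ 0`, `Ω > 0`, with `E = ‖g‖₂²` and `L = ∫_{|t| ≥ Ω} |ĝ(1/2+it)|²`:
`(2πE - L)³ ≤ 1024 (aΩ)³ e^{6aΩ} E L²`. -/
theorem weil_leak_cubic {g : ℝ → ℂ} {a Ω : ℝ} (hg : IsWeilTest g)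
    (hga : tsupport g ⊆ Icc (-a) a) (ha : 0 ≤ a) (hΩ : 0 < Ω) :
    (2 * π * weilNorm2Sq g - ∫ t in {t : ℝ | Ω ≤ |t|}, ‖weilMellin g (1 / 2 + t * I)‖ ^ 2) ^ 3
      ≤ 1024 * (a * Ω) ^ 3 * Real.exp (6 * (a * Ω)) * weilNorm2Sq g *
        (∫ t in {t : ℝ | Ω ≤ |t|}, ‖weilMellin g (1 / 2 + t * I)‖ ^ 2) ^ 2 := by
  obtain ⟨E, hE⟩ : ∃ E : ℝ, E = ∫ x : ℝ, ‖g x‖ ^ 2 := ⟨_, rfl⟩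
  have hEw : weilNorm2Sq g = E := by rw [hE]; rfl
  obtain ⟨L, hL⟩ : ∃ L : ℝ,
      L = ∫ t in {t : ℝ | Ω ≤ |t|}, ‖weilMellin g (1 / 2 + t * I)‖ ^ 2 := ⟨_, rfl⟩
  rw [hEw, ← hL]
  have hE0 : 0 ≤ E := by
    rw [hE]
    exact integral_nonneg fun _ ↦ by positivity
  have hL0 : 0 ≤ L := by
    rw [hL]
    exact integral_nonneg fun _ ↦ by positivity
  obtain ⟨K, hK⟩ : ∃ K : ℝ, K = a * (Real.sqrt (2 * a) * Real.sqrt E) := ⟨_, rfl⟩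
  have hK0 : 0 ≤ K := by
    rw [hK]
    positivity
  have hQ0 : 0 ≤ 8 * K * L := by positivity
  obtain ⟨η, hη0, hη3⟩ : ∃ η : ℝ, 0 ≤ η ∧ η ^ 3 = 8 * K * L :=
    ⟨(8 * K * L) ^ ((3 : ℕ) : ℝ)⁻¹, Real.rpow_nonneg hQ0 _,
      Real.rpow_inv_natCast_pow hQ0 three_ne_zero⟩
  -- pointwise bound outside the window
  have hout : ∀ t : ℝ, Ω ≤ |t| → ‖weilMellin g (1 / 2 + t * I)‖ ≤ η := by
    intro t ht
    have h3 : ‖weilMellin g (1 / 2 + t * I)‖ ^ 3 ≤ 8 * K * L := by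
      rcases hK0.eq_or_lt with hKz | hKp
      · have hb := norm_weilMellin_line_ext_le hg hga ha (t : ℂ)
        rw [← hE] at hb
        have hM : Real.sqrt (2 * a) * Real.sqrt E = 0 := by
          rcases mul_eq_zero.1 (hK.symm.trans hKz.symm) with h | h
          · rw [h, mul_zero, Real.sqrt_zero, zero_mul]
          · exact h
        rw [hM, zero_mul] at hb
        have h0 : ‖weilMellin g (1 / 2 + t * I)‖ = 0 := le_antisymm hb (norm_nonneg _)
        rw [h0]
        simp only [ne_eq, OfNat.ofNat_ne_zero, not_false_eq_true, zero_pow]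
        positivity
      · have hKp' : 0 < a * (Real.sqrt (2 * a) * Real.sqrt (∫ x : ℝ, ‖g x‖ ^ 2)) := by
          rw [← hE, ← hK]
          exact hKp
        have key := norm_pow_three_le_of_lipschitz (Ω := Ω) (t₀ := t)
          (F := fun t : ℝ ↦ weilMellin g (1 / 2 + t * I)) hKp'
          (norm_weilMellin_line_sub_le hg hga ha)
          (integrable_norm_sq_weilMellin_half_line hg).integrableOn ht
        rw [← hE, ← hK, ← hL] at key
        exact key
    rw [← hη3] at h3
    exact (pow_le_pow_iff_left₀ (norm_nonneg _) hη0 three_ne_zero).1 h3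
  -- energy inequality and the cube
  have hen := two_pi_weilNorm2Sq_le_leak_add hg hga ha hΩ hout
  rw [hEw, ← hL] at hen
  have he2 : Real.exp (a * Ω) ^ 2 = Real.exp (2 * (a * Ω)) := by
    rw [two_mul, Real.exp_add, sq]
  have he6 : Real.exp (2 * (a * Ω)) ^ 3 = Real.exp (6 * (a * Ω)) := by
    rw [show 6 * (a * Ω) = 2 * (a * Ω) + 2 * (a * Ω) + 2 * (a * Ω) by ring, Real.exp_add,
      Real.exp_add]
    ring
  have hdiff : 2 * π * E - L ≤ 2 * Ω * Real.exp (2 * (a * Ω)) * η ^ 2 := by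
    have : 2 * Ω * (η * Real.exp (a * Ω)) ^ 2 = 2 * Ω * Real.exp (2 * (a * Ω)) * η ^ 2 := by
      rw [mul_pow, he2]
      ring
    linarith [hen]
  have hdiff0 : 0 ≤ 2 * π * E - L := by
    have h1 : L ≤ ∫ t : ℝ, ‖weilMellin g (1 / 2 + t * I)‖ ^ 2 := by
      rw [hL]
      exact setIntegral_le_integral (integrable_norm_sq_weilMellin_half_line hg)
        (ae_of_all _ fun _ ↦ by simp only [Pi.zero_apply]; positivity)
    rw [integral_norm_sq_weilMellin_half_line hg, hEw] at h1
    linarith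
  have hsq2 : Real.sqrt (2 * a) ^ 2 = 2 * a := Real.sq_sqrt (by positivity)
  have hsqE : Real.sqrt E ^ 2 = E := Real.sq_sqrt hE0
  calc (2 * π * E - L) ^ 3 ≤ (2 * Ω * Real.exp (2 * (a * Ω)) * η ^ 2) ^ 3 :=
        pow_le_pow_left₀ hdiff0 hdiff 3
    _ = 8 * Ω ^ 3 * Real.exp (2 * (a * Ω)) ^ 3 * (η ^ 3) ^ 2 := by ring
    _ = 8 * Ω ^ 3 * Real.exp (6 * (a * Ω)) * (8 * K * L) ^ 2 := by rw [he6, hη3]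
    _ = 1024 * (a * Ω) ^ 3 * Real.exp (6 * (a * Ω)) * E * L ^ 2 := by
        rw [hK]
        have : (8 * (a * (Real.sqrt (2 * a) * Real.sqrt E)) * L) ^ 2 =
            64 * a ^ 2 * (Real.sqrt (2 * a) ^ 2 * Real.sqrt E ^ 2) * L ^ 2 := by ring
        rw [this, hsq2, hsqE]
        ring

/-- **Leak lower bound.** With `E, L` as above: if `L ≤ πE` then
`π^{3/2} E ≤ 32 (aΩ)^{3/2} e^{3aΩ} L`, i.e. `L ≥ π^{3/2} e^{-3aΩ} E / (32 (aΩ)^{3/2})`. -/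
theorem weil_leak_lower_bound {g : ℝ → ℂ} {a Ω : ℝ} (hg : IsWeilTest g)
    (hga : tsupport g ⊆ Icc (-a) a) (ha : 0 ≤ a) (hΩ : 0 < Ω)
    (hL : (∫ t in {t : ℝ | Ω ≤ |t|}, ‖weilMellin g (1 / 2 + t * I)‖ ^ 2) ≤ π * weilNorm2Sq g) :
    π * Real.sqrt π * weilNorm2Sq g ≤ 32 * ((a * Ω) * Real.sqrt (a * Ω)) *
      Real.exp (3 * (a * Ω)) * ∫ t in {t : ℝ | Ω ≤ |t|}, ‖weilMellin g (1 / 2 + t * I)‖ ^ 2 := by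
  have hcub := weil_leak_cubic hg hga ha hΩ
  have hE0 : 0 ≤ weilNorm2Sq g := weilNorm2Sq_nonneg g
  have hL0 : 0 ≤ ∫ t in {t : ℝ | Ω ≤ |t|}, ‖weilMellin g (1 / 2 + t * I)‖ ^ 2 :=
    integral_nonneg fun _ ↦ by positivity
  obtain ⟨L, hLdef⟩ : ∃ L : ℝ,
      L = ∫ t in {t : ℝ | Ω ≤ |t|}, ‖weilMellin g (1 / 2 + t * I)‖ ^ 2 := ⟨_, rfl⟩
  obtain ⟨E, hEdef⟩ : ∃ E : ℝ, E = weilNorm2Sq g := ⟨_, rfl⟩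
  obtain ⟨x, hx⟩ : ∃ x : ℝ, x = a * Ω := ⟨_, rfl⟩
  rw [← hLdef, ← hEdef, ← hx] at hcub
  rw [← hLdef, ← hEdef] at hL
  rw [← hLdef] at hL0
  rw [← hEdef] at hE0
  rw [← hLdef, ← hEdef, ← hx]
  have hx0 : 0 ≤ x := by
    rw [hx]
    exact mul_nonneg ha hΩ.le
  -- `(πE)³ ≤ (2πE - L)³ ≤ 1024 x³ e^{6x} E L²`
  have h1 : (π * E) ^ 3 ≤ 1024 * x ^ 3 * Real.exp (6 * x) * E * L ^ 2 :=
    (pow_le_pow_left₀ (by positivity) (by linarith) 3).trans hcub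
  rcases hE0.eq_or_lt with hEz | hEp
  · rw [← hEz, mul_zero]
    positivity
  -- divide by `E` and take square roots
  have h2 : (π * Real.sqrt π * E) ^ 2 ≤
      (32 * (x * Real.sqrt x) * Real.exp (3 * x) * L) ^ 2 := by
    have hπ : Real.sqrt π ^ 2 = π := Real.sq_sqrt Real.pi_pos.le
    have hxx : Real.sqrt x ^ 2 = x := Real.sq_sqrt hx0
    have he : Real.exp (3 * x) ^ 2 = Real.exp (6 * x) := by
      rw [sq, ← Real.exp_add]
      ring_nf
    have h3 : π ^ 3 * E ^ 2 ≤ 1024 * x ^ 3 * Real.exp (6 * x) * L ^ 2 := by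
      have h4 : π ^ 3 * E ^ 2 * E ≤ 1024 * x ^ 3 * Real.exp (6 * x) * L ^ 2 * E := by
        calc π ^ 3 * E ^ 2 * E = (π * E) ^ 3 := by ring
          _ ≤ 1024 * x ^ 3 * Real.exp (6 * x) * E * L ^ 2 := h1
          _ = 1024 * x ^ 3 * Real.exp (6 * x) * L ^ 2 * E := by ring
      exact le_of_mul_le_mul_right h4 hEp
    calc (π * Real.sqrt π * E) ^ 2 = π ^ 2 * Real.sqrt π ^ 2 * E ^ 2 := by ring
      _ = π ^ 3 * E ^ 2 := by rw [hπ]; ring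
      _ ≤ 1024 * x ^ 3 * Real.exp (6 * x) * L ^ 2 := h3
      _ = 1024 * (x ^ 2 * Real.sqrt x ^ 2) * Real.exp (3 * x) ^ 2 * L ^ 2 := by
          rw [hxx, he]; ring
      _ = (32 * (x * Real.sqrt x) * Real.exp (3 * x) * L) ^ 2 := by ring
  exact (pow_le_pow_iff_left₀ (by positivity) (by positivity) two_ne_zero).1 h2

/-- **Headline.** For a test function `g` supported in `[-a, a]` and `aΩ ≥ 1`:
`∫_{|t| ≥ Ω} |ĝ(1/2+it)|² dt ≥ e^{-6aΩ} ∫ |g|²` — a time-limited function leaks at least the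
fraction `e^{-6aΩ}/(2π)` of its energy outside the frequency window `[-Ω, Ω]`. -/
theorem weil_leak_ge_exp_neg {g : ℝ → ℂ} {a Ω : ℝ} (hg : IsWeilTest g)
    (hga : tsupport g ⊆ Icc (-a) a) (ha : 0 ≤ a) (hΩ : 0 < Ω) (h1 : 1 ≤ a * Ω) :
    Real.exp (-(6 * (a * Ω))) * weilNorm2Sq g ≤
      ∫ t in {t : ℝ | Ω ≤ |t|}, ‖weilMellin g (1 / 2 + t * I)‖ ^ 2 := by
  have hE0 : 0 ≤ weilNorm2Sq g := weilNorm2Sq_nonneg g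
  have hL0 : 0 ≤ ∫ t in {t : ℝ | Ω ≤ |t|}, ‖weilMellin g (1 / 2 + t * I)‖ ^ 2 :=
    integral_nonneg fun _ ↦ by positivity
  have hlb := fun h ↦ weil_leak_lower_bound hg hga ha hΩ h
  obtain ⟨L, hLdef⟩ : ∃ L : ℝ,
      L = ∫ t in {t : ℝ | Ω ≤ |t|}, ‖weilMellin g (1 / 2 + t * I)‖ ^ 2 := ⟨_, rfl⟩
  obtain ⟨E, hEdef⟩ : ∃ E : ℝ, E = weilNorm2Sq g := ⟨_, rfl⟩
  obtain ⟨x, hx⟩ : ∃ x : ℝ, x = a * Ω := ⟨_, rfl⟩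
  rw [← hLdef, ← hEdef, ← hx] at hlb
  rw [← hLdef] at hL0
  rw [← hEdef] at hE0
  rw [← hLdef, ← hEdef, ← hx]
  have hx1 : 1 ≤ x := by
    rw [hx]
    exact h1
  have hex : Real.exp (-(6 * x)) ≤ 1 := Real.exp_le_one_iff.2 (by linarith)
  rcases le_or_gt L (π * E) with hL | hL
  · have key := hlb hL
    -- `32 x√x e^{3x} ≤ π√π e^{6x}`
    have hπ3 : 3 ≤ π := by linarith [Real.pi_gt_three]
    have hsπ : 4 / 3 ≤ Real.sqrt π := by
      rw [Real.le_sqrt (by norm_num) Real.pi_pos.le]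
      nlinarith
    have hππ : 4 ≤ π * Real.sqrt π := by nlinarith
    have hsx : Real.sqrt x ^ 2 = x := Real.sq_sqrt (by linarith)
    have hsx0 : 0 ≤ Real.sqrt x := Real.sqrt_nonneg _
    -- `2 √x ≤ 1 + x`, so `8 x √x ≤ (1 + x)³ ≤ e^{3x}`
    have ham : 2 * Real.sqrt x ≤ x + 1 := by nlinarith [sq_nonneg (Real.sqrt x - 1)]
    have hcube : 8 * (x * Real.sqrt x) ≤ Real.exp (3 * x) := by
      have h2 : (2 * Real.sqrt x) ^ 3 ≤ (x + 1) ^ 3 := pow_le_pow_left₀ (by positivity) ham 3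
      have h3 : (x + 1) ^ 3 ≤ Real.exp x ^ 3 :=
        pow_le_pow_left₀ (by linarith) (Real.add_one_le_exp x) 3
      have h4 : Real.exp x ^ 3 = Real.exp (3 * x) := by
        rw [show 3 * x = x + x + x by ring, Real.exp_add, Real.exp_add]
        ring
      have h5 : (2 * Real.sqrt x) ^ 3 = 8 * (x * Real.sqrt x) := by
        rw [show (2 * Real.sqrt x) ^ 3 = 8 * (Real.sqrt x ^ 2 * Real.sqrt x) by ring, hsx]
      linarith [h2, h3, h4.le, h4.ge]
    have h6 : Real.exp (6 * x) = Real.exp (3 * x) * Real.exp (3 * x) := by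
      rw [← Real.exp_add]; ring_nf
    -- combine
    have h7 : 32 * (x * Real.sqrt x) * Real.exp (3 * x) ≤ π * Real.sqrt π * Real.exp (6 * x) := by
      rw [h6]
      have := mul_le_mul hππ hcube (by positivity) (by positivity)
      nlinarith [Real.exp_pos (3 * x), this]
    have h8 : π * Real.sqrt π * E ≤ π * Real.sqrt π * Real.exp (6 * x) * L := by
      calc π * Real.sqrt π * E ≤ 32 * (x * Real.sqrt x) * Real.exp (3 * x) * L := key
        _ ≤ π * Real.sqrt π * Real.exp (6 * x) * L := mul_le_mul_of_nonneg_right h7 hL0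
    have hππ0 : 0 < π * Real.sqrt π := by positivity
    have h9 : E ≤ Real.exp (6 * x) * L := by
      have := h8
      rw [mul_assoc (π * Real.sqrt π) (Real.exp (6 * x)) L] at this
      exact le_of_mul_le_mul_left this hππ0
    calc Real.exp (-(6 * x)) * E ≤ Real.exp (-(6 * x)) * (Real.exp (6 * x) * L) :=
          mul_le_mul_of_nonneg_left h9 (Real.exp_pos _).le
      _ = L := by rw [← mul_assoc, ← Real.exp_add, neg_add_cancel, Real.exp_zero, one_mul]
  · have hπ1 : E ≤ π * E := le_mul_of_one_le_left hE0 (by linarith [Real.pi_gt_three])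
    calc Real.exp (-(6 * x)) * E ≤ 1 * E := mul_le_mul_of_nonneg_right hex hE0
      _ ≤ L := by linarith

end Summit.RiemannHypothesis.RiemannHypothesis.Theorems
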